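import Summits.CriticalPhenomena.PercolationContinuityZ3.Theorems.PercNearOneGluingNoHeavyLowerTailSahiGridPatternSliceForm

/-!
# `NoHeavyLowerTail` (crux stmt-CriticalPhenomena-4575), Sahi programme: slicing the pattern tensor along the last axis, and
# **COEFFICIENTWISE HARRIS ON `[3]^n` IN EVERY DIMENSION**

Support file (seat `prim-ineq-gen-4`, generation 11; `--supports stmt-CriticalPhenomena-4575`).  Pure proofs, no definitions, no `sorry`,
standard axioms.  Vocabulary of `…SahiGridPattern{,Tensor,AllDim,SliceForm}` (`Pd`, `tcD`, `c1 c2 c3`, `TotDist`, `ind`).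

* `tcD_snoc` — the pattern tensor at points `Fin.snoc p i, Fin.snoc q j, Fin.snoc r k` of `[3]^{n+1}` factorises into the five axis-products
  over `[3]^n` times the per-axis counts `c1 i j k, c2 …, c3 i j k` of the last axis (the basis of every slice computation: top-slice dominance,
  lifting lemmas, cylinder formulas).  `totDist_snoc_iff`, `sum_snoc` are the matching bookkeeping facts.
* `tdPairs_le_card_inter` (**coefficientwise Harris, every `n`**): for up-sets `U, V ⊆ [3]^n`,
  `#{(p,q) ∈ U × V : p, q differ in every axis} ≤ 2^n · #(U ∩ V)`,
  i.e. the two-copy pattern functional `2^n|U∩V| − N(U,V)` is nonnegative — the coefficientwise (Latin-hypercube) form of Harris' inequality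
  for product weights on grids, in every dimension.  Proof: induction on `n` by slicing the last axis; the slices `U_i = {p : snoc p i ∈ U}`
  are nested up-sets, `N_{n+1}(U,V) = Σ_{i≠j} N_n(U_i,V_j) ≤ 2^n Σ_{i≠j} |U_i ∩ V_j| ≤ 2^n · 2 Σ_i |U_i ∩ V_i| = 2^{n+1}|U ∩ V|`, the middle
  step being the pointwise fact `fg − min(f,g) ≤ 2 min(f,g)` for `f, g ≤ 3`.
Used by this seat's top-slice-dominance theorems (memo `run/shared/lean/prim/prim-ineq-gen-4/FINDING-TOP-SLICE-DOMINANCE-g11.md` §2c). [this work]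
-/

namespace Summit.CriticalPhenomena.PercolationContinuityZ3.Theorems.SahiGridPattern

open Finset SahiGrid3
open scoped BigOperators

variable {n : ℕ}

/-! ### Slicing along the last axis -/

/-- **The pattern tensor on `snoc` points factorises over the last axis.** [this work] -/
theorem tcD_snoc (p q r : Pd n) (i j k : Fin 3) :
    tcD (Fin.snoc p i : Pd (n + 1)) (Fin.snoc q j) (Fin.snoc r k) =
      2 * (∏ a, c1 (p a) (q a) (r a)) * c1 i j k - (∏ a, c2 (p a) (q a) (r a)) * c2 i j k
      - (∏ a, c2 (q a) (p a) (r a)) * c2 j i k - (∏ a, c2 (r a) (p a) (q a)) * c2 k i j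
      + (∏ a, c3 (p a) (q a) (r a)) * c3 i j k := by
  unfold tcD
  simp only [Fin.prod_univ_castSucc, Fin.snoc_castSucc, Fin.snoc_last]
  ring

/-- Two `snoc` points differ in every axis iff their initial parts do and their last coordinates differ. [this work] -/
theorem totDist_snoc_iff (p q : Pd n) (i j : Fin 3) :
    TotDist (Fin.snoc p i : Pd (n + 1)) (Fin.snoc q j) = true ↔ (TotDist p q = true ∧ i ≠ j) := by
  rw [totDist_iff, totDist_iff]
  constructor
  · intro h
    refine ⟨fun a => ?_, ?_⟩
    · have := h (Fin.castSucc a); simpa [Fin.snoc_castSucc] using this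
    · have := h (Fin.last n); simpa [Fin.snoc_last] using this
  · rintro ⟨h1, h2⟩ a
    refine Fin.lastCases ?_ (fun b => ?_) a
    · simpa [Fin.snoc_last] using h2
    · simpa [Fin.snoc_castSucc] using h1 b

/-- Summing over `[3]^{n+1}` = summing over the last coordinate and over `[3]^n`. [this work] -/
theorem sum_snoc {M : Type*} [AddCommMonoid M] (f : Pd (n + 1) → M) :
    ∑ x, f x = ∑ i : Fin 3, ∑ p : Pd n, f (Fin.snoc p i) := by
  rw [← (Fin.snocEquiv fun _ : Fin (n + 1) => Fin 3).sum_comp, Fintype.sum_prod_type]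
  rfl

/-- `snoc p i ≤ snoc p j` for `i ≤ j`. [this work] -/
theorem snoc_le_snoc_of_le (p : Pd n) {i j : Fin 3} (hij : i ≤ j) :
    (Fin.snoc p i : Pd (n + 1)) ≤ Fin.snoc p j := by
  intro a
  refine Fin.lastCases ?_ (fun b => ?_) a
  · simpa [Fin.snoc_last] using hij
  · simp [Fin.snoc_castSucc]

/-- `snoc p i ≤ snoc q i` for `p ≤ q`. [this work] -/
theorem snoc_le_snoc_of_le_left {p q : Pd n} (hpq : p ≤ q) (i : Fin 3) :
    (Fin.snoc p i : Pd (n + 1)) ≤ Fin.snoc q i := by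
  intro a
  refine Fin.lastCases ?_ (fun b => ?_) a
  · simp [Fin.snoc_last]
  · simpa [Fin.snoc_castSucc] using hpq b

/-- The level-`i` slice `{p : snoc p i ∈ U}` of an up-set of `[3]^{n+1}` is an up-set of `[3]^n`. [this work] -/
theorem isUpperSet_filter_snoc {U : Finset (Pd (n + 1))} (hU : IsUpperSet (U : Set (Pd (n + 1)))) (i : Fin 3) :
    IsUpperSet ((univ.filter fun p : Pd n => (Fin.snoc p i : Pd (n + 1)) ∈ U : Finset (Pd n)) : Set (Pd n)) := by
  intro p q hpq hp
  rw [Finset.mem_coe, mem_filter] at hp ⊢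
  exact ⟨mem_univ _, hU (snoc_le_snoc_of_le_left hpq i) hp.2⟩

/-- Indicator of a slice. [this work] -/
theorem ind_filter_snoc (U : Finset (Pd (n + 1))) (i : Fin 3) (p : Pd n) :
    ind (univ.filter fun p : Pd n => (Fin.snoc p i : Pd (n + 1)) ∈ U) p = ind U (Fin.snoc p i) := by
  unfold ind
  simp only [mem_filter, mem_univ, true_and]

/-- Slices of an up-set are nested: the indicator is monotone in the level. [this work] -/
theorem ind_snoc_mono {U : Finset (Pd (n + 1))} (hU : IsUpperSet (U : Set (Pd (n + 1)))) (p : Pd n) {i j : Fin 3} (hij : i ≤ j) :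
    ind U (Fin.snoc p i) ≤ ind U (Fin.snoc p j) := by
  unfold ind
  by_cases h : (Fin.snoc p i : Pd (n + 1)) ∈ U
  · have : (Fin.snoc p j : Pd (n + 1)) ∈ U := hU (snoc_le_snoc_of_le p hij) h
    rw [if_pos h, if_pos this]
  · rw [if_neg h]; split_ifs <;> norm_num

/-- `ind` takes the values `0, 1`. [this work] -/
theorem ind_eq_zero_or_one {Y : Type*} [DecidableEq Y] (S : Finset Y) (y : Y) : ind S y = 0 ∨ ind S y = 1 := by
  unfold ind; split_ifs <;> simp

/-! ### Coefficientwise Harris on `[3]^n` -/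

/-- The pointwise step of the Harris induction: for `0 ≤ u₀ ≤ u₁ ≤ u₂ ≤ 1` and `0 ≤ v₀ ≤ v₁ ≤ v₂ ≤ 1` integers,
`Σ_{i≠j} uᵢvⱼ ≤ 2 Σ_i uᵢvᵢ` (i.e. `fg − min(f,g) ≤ 2 min(f,g)`). [this work] -/
theorem offdiag_le_two_diag (u0 u1 u2 v0 v1 v2 : ℤ) (hu0 : u0 = 0 ∨ u0 = 1) (hu1 : u1 = 0 ∨ u1 = 1) (hu2 : u2 = 0 ∨ u2 = 1)
    (hu01 : u0 ≤ u1) (hu12 : u1 ≤ u2) (hv01 : v0 ≤ v1) (hv12 : v1 ≤ v2) :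
    u0 * v1 + u0 * v2 + u1 * v0 + u1 * v2 + u2 * v0 + u2 * v1 ≤ 2 * (u0 * v0 + u1 * v1 + u2 * v2) := by
  rcases hu0 with rfl | rfl <;> rcases hu1 with rfl | rfl <;> rcases hu2 with rfl | rfl <;> omega

/-- The two-copy "totally distinct pairs" count of `U × V` as an indicator sum (bookkeeping). [this work] -/
theorem sum_sum_ind_totDist_eq_card (U V : Finset (Pd n)) :
    (∑ p, ∑ q, ind U p * ind V q * (if TotDist p q = true then (1 : ℤ) else 0)) =
      (((U ×ˢ V).filter fun pq => TotDist pq.1 pq.2 = true).card : ℤ) := by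
  rw [Finset.card_filter, Nat.cast_sum, Finset.sum_product]
  rw [← Finset.sum_subset (Finset.subset_univ U) (fun p _ hp => by
        refine Finset.sum_eq_zero fun q _ => ?_
        unfold ind; rw [if_neg hp]; ring)]
  refine Finset.sum_congr rfl fun p hp => ?_
  rw [← Finset.sum_subset (Finset.subset_univ V) (fun q _ hq => by unfold ind; rw [if_neg hq]; ring)]
  refine Finset.sum_congr rfl fun q hq => ?_
  unfold ind; rw [if_pos hp, if_pos hq]; push_cast; split_ifs <;> simp

/-- `#(U ∩ V)` as an indicator sum (bookkeeping). [this work] -/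
theorem sum_ind_mul_ind_eq_card (U V : Finset (Pd n)) : (∑ p, ind U p * ind V p) = ((U ∩ V).card : ℤ) := by
  unfold ind
  rw [Finset.card_eq_sum_ones, Nat.cast_sum]
  rw [← Finset.sum_subset (Finset.subset_univ (U ∩ V)) (fun p _ hp => by
        rw [mem_inter, not_and_or] at hp
        rcases hp with h | h
        · rw [if_neg h]; ring
        · rw [if_neg h]; ring)]
  refine Finset.sum_congr rfl fun p hp => ?_
  rw [mem_inter] at hp
  simp [hp.1, hp.2]

/-- **Coefficientwise Harris on `[3]^n`, indicator form** (every `n`): for up-sets `U, V`,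
`Σ_{p,q} 1_U(p) 1_V(q) [p δ̸ q] ≤ 2^n · Σ_p 1_U(p) 1_V(p)`. [this work] -/
theorem sum_ind_totDist_le : ∀ (n : ℕ) (U V : Finset (Pd n)), IsUpperSet (U : Set (Pd n)) → IsUpperSet (V : Set (Pd n)) →
    (∑ p, ∑ q, ind U p * ind V q * (if TotDist p q = true then (1 : ℤ) else 0)) ≤ 2 ^ n * ∑ p, ind U p * ind V p := by
  intro n
  induction n with
  | zero =>
    intro U V _ _
    -- `[3]^0` is a single point
    have hsub : ∀ p q : Pd 0, p = q := fun p q => funext fun a => a.elim0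
    have huniv : (Finset.univ : Finset (Pd 0)) = {fun a => a.elim0} := by
      ext p; simp only [mem_univ, mem_singleton, true_iff]; exact hsub _ _
    simp only [huniv, Finset.sum_singleton, pow_zero, one_mul]
    rcases ind_eq_zero_or_one U (fun a : Fin 0 => a.elim0) with h | h <;>
      rcases ind_eq_zero_or_one V (fun a : Fin 0 => a.elim0) with h' | h' <;> rw [h, h'] <;> split_ifs <;> norm_num
  | succ n ih =>
    intro U V hU hV
    -- the slices
    set Us : Fin 3 → Finset (Pd n) := fun i => univ.filter fun p : Pd n => (Fin.snoc p i : Pd (n + 1)) ∈ U with hUs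
    set Vs : Fin 3 → Finset (Pd n) := fun i => univ.filter fun p : Pd n => (Fin.snoc p i : Pd (n + 1)) ∈ V with hVs
    have hU' : ∀ i p, ind U (Fin.snoc p i) = ind (Us i) p := fun i p => (ind_filter_snoc U i p).symm
    have hV' : ∀ i p, ind V (Fin.snoc p i) = ind (Vs i) p := fun i p => (ind_filter_snoc V i p).symm
    have htd : ∀ (p q : Pd n) (i j : Fin 3), (if TotDist (Fin.snoc p i : Pd (n + 1)) (Fin.snoc q j) = true then (1 : ℤ) else 0) =
        (if TotDist p q = true then (1 : ℤ) else 0) * (if i ≠ j then 1 else 0) := by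
      intro p q i j
      by_cases h1 : TotDist p q = true
      · by_cases h2 : i ≠ j
        · rw [if_pos ((totDist_snoc_iff p q i j).2 ⟨h1, h2⟩), if_pos h1, if_pos h2]; ring
        · rw [if_neg (fun h => h2 ((totDist_snoc_iff p q i j).1 h).2), if_pos h1, if_neg h2]; ring
      · rw [if_neg (fun h => h1 ((totDist_snoc_iff p q i j).1 h).1), if_neg h1]; ring
    -- slice the left-hand side
    have hL : (∑ p : Pd (n + 1), ∑ q : Pd (n + 1), ind U p * ind V q * (if TotDist p q = true then (1 : ℤ) else 0)) =
        ∑ i : Fin 3, ∑ j : Fin 3, (if i ≠ j then (1 : ℤ) else 0) *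
          (∑ p : Pd n, ∑ q : Pd n, ind (Us i) p * ind (Vs j) q * (if TotDist p q = true then (1 : ℤ) else 0)) := by
      rw [sum_snoc (fun p : Pd (n + 1) => ∑ q : Pd (n + 1), ind U p * ind V q * (if TotDist p q = true then (1 : ℤ) else 0))]
      refine Finset.sum_congr rfl fun i _ => ?_
      have inner : ∀ p : Pd n, (∑ q : Pd (n + 1), ind U (Fin.snoc p i) * ind V q *
          (if TotDist (Fin.snoc p i : Pd (n + 1)) q = true then (1 : ℤ) else 0)) =
          ∑ j : Fin 3, ∑ q : Pd n, (if i ≠ j then (1 : ℤ) else 0) *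
            (ind (Us i) p * ind (Vs j) q * (if TotDist p q = true then (1 : ℤ) else 0)) := by
        intro p
        rw [sum_snoc (fun q : Pd (n + 1) => ind U (Fin.snoc p i) * ind V q *
          (if TotDist (Fin.snoc p i : Pd (n + 1)) q = true then (1 : ℤ) else 0))]
        refine Finset.sum_congr rfl fun j _ => Finset.sum_congr rfl fun q _ => ?_
        rw [hU', hV', htd]; ring
      rw [Finset.sum_congr rfl fun p _ => inner p, Finset.sum_comm]
      refine Finset.sum_congr rfl fun j _ => ?_
      rw [Finset.mul_sum]
      refine Finset.sum_congr rfl fun p _ => ?_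
      rw [Finset.mul_sum]
    -- slice the right-hand side
    have hR : (∑ p : Pd (n + 1), ind U p * ind V p) = ∑ p : Pd n, ∑ i : Fin 3, ind (Us i) p * ind (Vs i) p := by
      rw [sum_snoc (fun p : Pd (n + 1) => ind U p * ind V p), Finset.sum_comm]
      refine Finset.sum_congr rfl fun p _ => Finset.sum_congr rfl fun i _ => ?_
      rw [hU', hV']
    rw [hL, hR]
    -- bound each block by the induction hypothesis
    have hblock : ∀ i j : Fin 3, (if i ≠ j then (1 : ℤ) else 0) *
          (∑ p : Pd n, ∑ q : Pd n, ind (Us i) p * ind (Vs j) q * (if TotDist p q = true then (1 : ℤ) else 0)) ≤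
        (if i ≠ j then (1 : ℤ) else 0) * (2 ^ n * ∑ p : Pd n, ind (Us i) p * ind (Vs j) p) := by
      intro i j
      have hih := ih (Us i) (Vs j) (by rw [hUs]; exact isUpperSet_filter_snoc hU i) (by rw [hVs]; exact isUpperSet_filter_snoc hV j)
      by_cases hij : i ≠ j
      · rw [if_pos hij, one_mul, one_mul]; exact hih
      · rw [if_neg hij, zero_mul, zero_mul]
    have hle : (∑ i : Fin 3, ∑ j : Fin 3, (if i ≠ j then (1 : ℤ) else 0) *
          (∑ p : Pd n, ∑ q : Pd n, ind (Us i) p * ind (Vs j) q * (if TotDist p q = true then (1 : ℤ) else 0))) ≤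
        ∑ i : Fin 3, ∑ j : Fin 3, (if i ≠ j then (1 : ℤ) else 0) * (2 ^ n * ∑ p : Pd n, ind (Us i) p * ind (Vs j) p) :=
      Finset.sum_le_sum fun i _ => Finset.sum_le_sum fun j _ => hblock i j
    refine le_trans hle ?_
    -- pointwise: Σ_{i≠j} u_i v_j ≤ 2 Σ_i u_i v_i
    have hpt : ∀ p : Pd n, (∑ i : Fin 3, ∑ j : Fin 3, (if i ≠ j then (1 : ℤ) else 0) * (ind (Us i) p * ind (Vs j) p)) ≤
        2 * ∑ i : Fin 3, ind (Us i) p * ind (Vs i) p := by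
      intro p
      have m01U := ind_snoc_mono hU p (show (0 : Fin 3) ≤ 1 by decide)
      have m12U := ind_snoc_mono hU p (show (1 : Fin 3) ≤ 2 by decide)
      have m01V := ind_snoc_mono hV p (show (0 : Fin 3) ≤ 1 by decide)
      have m12V := ind_snoc_mono hV p (show (1 : Fin 3) ≤ 2 by decide)
      rw [hU', hU'] at m01U m12U; rw [hV', hV'] at m01V m12V
      have key := offdiag_le_two_diag (ind (Us 0) p) (ind (Us 1) p) (ind (Us 2) p) (ind (Vs 0) p) (ind (Vs 1) p) (ind (Vs 2) p)
        (ind_eq_zero_or_one _ _) (ind_eq_zero_or_one _ _) (ind_eq_zero_or_one _ _) m01U m12U m01V m12V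
      simp only [Fin.sum_univ_three]
      simp only [ne_eq, not_true_eq_false, if_false, zero_mul, Fin.isValue, zero_add, add_zero]
      have h01 : ((0 : Fin 3) = 1) = False := by decide
      have h02 : ((0 : Fin 3) = 2) = False := by decide
      have h10 : ((1 : Fin 3) = 0) = False := by decide
      have h12 : ((1 : Fin 3) = 2) = False := by decide
      have h20 : ((2 : Fin 3) = 0) = False := by decide
      have h21 : ((2 : Fin 3) = 1) = False := by decide
      simp only [h01, h02, h10, h12, h20, h21, not_false_eq_true, if_true, one_mul]
      linarith
    -- reassemble: Σ_i Σ_j [i≠j] 2^n Σ_p (…) = 2^n Σ_p Σ_i Σ_j [i≠j] (…)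
    have hre : (∑ i : Fin 3, ∑ j : Fin 3, (if i ≠ j then (1 : ℤ) else 0) * (2 ^ n * ∑ p : Pd n, ind (Us i) p * ind (Vs j) p)) =
        2 ^ n * ∑ p : Pd n, (∑ i : Fin 3, ∑ j : Fin 3, (if i ≠ j then (1 : ℤ) else 0) * (ind (Us i) p * ind (Vs j) p)) := by
      set F : Fin 3 → Fin 3 → Pd n → ℤ := fun i j p => (2 : ℤ) ^ n * ((if i ≠ j then (1 : ℤ) else 0) * (ind (Us i) p * ind (Vs j) p)) with hF
      have e1 : (∑ i : Fin 3, ∑ j : Fin 3, (if i ≠ j then (1 : ℤ) else 0) * (2 ^ n * ∑ p : Pd n, ind (Us i) p * ind (Vs j) p)) =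
          ∑ i : Fin 3, ∑ j : Fin 3, ∑ p : Pd n, F i j p := by
        refine Finset.sum_congr rfl fun i _ => Finset.sum_congr rfl fun j _ => ?_
        rw [hF, Finset.mul_sum, Finset.mul_sum]
        refine Finset.sum_congr rfl fun p _ => ?_
        ring
      have e2 : (∑ i : Fin 3, ∑ j : Fin 3, ∑ p : Pd n, F i j p) = ∑ i : Fin 3, ∑ p : Pd n, ∑ j : Fin 3, F i j p :=
        Finset.sum_congr rfl fun i _ => Finset.sum_comm
      have e3 : (∑ i : Fin 3, ∑ p : Pd n, ∑ j : Fin 3, F i j p) = ∑ p : Pd n, ∑ i : Fin 3, ∑ j : Fin 3, F i j p := Finset.sum_comm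
      have e4 : (2 : ℤ) ^ n * ∑ p : Pd n, (∑ i : Fin 3, ∑ j : Fin 3, (if i ≠ j then (1 : ℤ) else 0) * (ind (Us i) p * ind (Vs j) p)) =
          ∑ p : Pd n, ∑ i : Fin 3, ∑ j : Fin 3, F i j p := by
        rw [Finset.mul_sum]
        refine Finset.sum_congr rfl fun p _ => ?_
        rw [Finset.mul_sum]
        refine Finset.sum_congr rfl fun i _ => ?_
        rw [Finset.mul_sum]
      rw [e1, e2, e3, e4]
    rw [hre, pow_succ]
    have h2 : (2 : ℤ) ^ n * ∑ p : Pd n, (∑ i : Fin 3, ∑ j : Fin 3, (if i ≠ j then (1 : ℤ) else 0) * (ind (Us i) p * ind (Vs j) p))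
        ≤ 2 ^ n * ∑ p : Pd n, (2 * ∑ i : Fin 3, ind (Us i) p * ind (Vs i) p) :=
      mul_le_mul_of_nonneg_left (Finset.sum_le_sum fun p _ => hpt p) (pow_nonneg (by norm_num) n)
    refine le_trans h2 (le_of_eq ?_)
    rw [← Finset.mul_sum]
    ring

/-- **COEFFICIENTWISE HARRIS ON `[3]^n`** (every `n`): for up-sets `U, V ⊆ [3]^n`, the number of totally distinct pairs in `U × V` is at most
`2^n · #(U ∩ V)`. [this work] -/
theorem tdPairs_le_card_inter (U V : Finset (Pd n)) (hU : IsUpperSet (U : Set (Pd n))) (hV : IsUpperSet (V : Set (Pd n))) :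
    (((U ×ˢ V).filter fun pq => TotDist pq.1 pq.2 = true).card : ℤ) ≤ 2 ^ n * ((U ∩ V).card : ℤ) := by
  rw [← sum_sum_ind_totDist_eq_card, ← sum_ind_mul_ind_eq_card]
  exact sum_ind_totDist_le n U V hU hV

end Summit.CriticalPhenomena.PercolationContinuityZ3.Theorems.SahiGridPattern
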